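import Mathlib.Analysis.Distribution.FourierMultiplier
import Mathlib.Analysis.InnerProductSpace.Adjoint
import Literature.Analysis.FunctionSpaces.SchwartzExchange
import Literature.Analysis.FunctionSpaces.SchwartzParametric
import Literature.MathematicalPhysics.QuantumLattice.SchwartzTranslationCutoff
import HarnessLib

/-!
# Schwartz-weighted averages of translates and their exchange with tempered distributions

Topic `Literature/Analysis/FunctionSpaces` (support file for the spectral condition (b) of the
Wightman distributions, `Literature.MathematicalPhysics.QuantumLattice.IsWightmanQFT.hasSpectralCondition_family` of
`WightmanFunctionsFamilyProofs`, i.e. Streater–Wightman (1964), §3-3, Thm. 3-2 (b)).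

Let `P`, `V` be finite-dimensional real inner product spaces, `A : P →L[ℝ] V`, `h ∈ 𝓢(P, ℂ)`.
For `u ∈ 𝓢(V, ℂ)` the **weighted average of translates**

  `(K_{A,h} u)(x) = ∫_P h(a) u(x − A a) da`

is again a Schwartz function; it is the Fourier multiplier with symbol `p ↦ 𝓕h(A†p)`
(`translationAverage A h = SchwartzMap.fourierMultiplierCLM ℂ (averagingMultiplier A h)`,
`translationAverage_apply`, `fourier_translationAverage_apply`). The main result is the
**exchange lemma** (`integral_mul_apply_compSubConstCLM`): for every tempered distribution
`T : 𝓢(V, ℂ) →L[ℂ] ℂ`,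

  `∫_P h(a) T(u(· − A a)) da = T(K_{A,h} u)`,

the rigorous form of "`∫ h(a) ⟨T, τ_{Aa} u⟩ da = ⟨T, ∫ h(a) τ_{Aa} u da⟩`" used in
Streater–Wightman's proof of Thm. 3-2 (b) (PDF p. 96 of the 2000 printing: the passage from
`∫ e^{ipa} da (Ψ₀, φ₁(f₁)…φⱼ(fⱼ) U(-a,1) φⱼ₊₁(fⱼ₊₁)…Ψ₀) = 0` to the support of `W̃`), and in
Reed–Simon II, §IX.1 (operations on tempered distributions defined by duality).

## Proof

* *Pointwise formula* (`translationAverage_apply`): `x ↦ ∫ h(a) u(x − Aa) da` is continuous and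
  integrable (Fubini, `integrable_kernel`), its Fourier transform is `𝓕h(A†·) · 𝓕u`
  (`fourier_average`: Fubini and `𝓕(u(· − v))(p) = e^{-2πi⟨v,p⟩} 𝓕u(p)`), which is integrable;
  Fourier inversion (`Continuous.fourierInv_fourier_eq`) identifies it with the multiplier.
* *Derivatives* (`iteratedFDeriv_translationAverage`): Fourier multipliers commute with
  directional derivatives (`SchwartzMap.lineDeriv_eq_fourierMultiplierCLM`), so
  `Dˡ(K u)(x) = ∫ h(a) Dˡu(x − Aa) da`.
* *Exchange* (`integral_mul_apply_compSubConstCLM`): an instance of the tree's general theorem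
  that tempered distributions commute with Schwartz-valued integrals,
  `SchwartzMap.apply_eq_integral_of_forall_apply_eq_integral` (`SchwartzExchange`: `T` is bounded
  by finitely many seminorms, i.e. by the norm of the derivative embedding
  `SchwartzMap.derivEmbedding` into a Banach space, and the Bochner integral there commutes with
  bounded functionals), applied to the continuous family of translates `a ↦ u(· − Aa)`
  (`Literature.MathematicalPhysics.QuantumLattice.continuous_compSubConstCLM`, `SchwartzTranslationCutoff`), whose seminorms grow
  polynomially in `a` (`SchwartzMap.exists_seminorm_clm_compSubConstCLM_le`, `SchwartzParametric`),
  with the polynomially integrable weight `h` (`SchwartzMap.integrable_one_add_norm_pow_mul`) and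
  the pointwise identity `translationAverage_apply`. The same growth bounds give the
  integrability of `a ↦ h(a) T(u(· − Aa))` (`integrable_mul_apply_compSubConstCLM`).

## References

* R. F. Streater, A. S. Wightman, *PCT, Spin and Statistics, and All That* (1964; Princeton
  2000 printing), §3-3, proof of Thm. 3-2 (b), PDF pp. 96–97; §2-6 (spectral condition of the
  translation group). [StreaterWightman1964]
* M. Reed, B. Simon, *Methods of Modern Mathematical Physics II: Fourier Analysis,
  Self-Adjointness* (1975), §IX.1 (tempered distributions, Fourier transform and translations by
  duality). [ReedSimonII1975]

## Mathlib / tree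

`SchwartzMap.fourierMultiplierCLM`, `SchwartzMap.lineDeriv_eq_fourierMultiplierCLM`,
`SchwartzMap.fourierMultiplierCLM_fourierMultiplierCLM_apply`, `SchwartzMap.smulLeftCLM`,
`Real.fourier_eq`, `Continuous.fourierInv_fourier_eq`, `MeasureTheory.integrable_prod_iff'`,
`MeasureTheory.integral_integral_swap`, `ContinuousLinearMap.adjoint`,
`ContinuousMultilinearMap.integral_apply`, `Seminorm.bound_of_continuous`; tree (imported, not
re-proved here): `SchwartzMap.apply_eq_integral_of_forall_apply_eq_integral` (`SchwartzExchange`),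
`SchwartzMap.exists_seminorm_clm_compSubConstCLM_le`, `SchwartzMap.integrable_one_add_norm_pow_mul`
(`SchwartzParametric`), `Literature.MathematicalPhysics.QuantumLattice.continuous_compSubConstCLM` (`SchwartzTranslationCutoff`).
New here: the multiplier `averagingMultiplier`, the operator `translationAverage`, its pointwise,
Fourier and derivative formulas, and the exchange/integrability corollaries for translates.
-/

noncomputable section

open MeasureTheory Filter Topology FourierTransform RealInnerProductSpace Complex
open scoped SchwartzMap InnerProductSpace

namespace Literature.Analysis.FunctionSpaces

namespace SchwartzAverage

/-! ### The multiplier `p ↦ 𝓕h(A†p)` -/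

section Multiplier

variable {P V : Type*}
  [NormedAddCommGroup P] [InnerProductSpace ℝ P] [FiniteDimensional ℝ P]
  [MeasurableSpace P] [BorelSpace P]
  [NormedAddCommGroup V] [InnerProductSpace ℝ V] [FiniteDimensional ℝ V]

/-- The symbol of the averaging operator: `p ↦ 𝓕h(A†p)`, `A† : V → P` the adjoint of `A`
(the Fourier transform of the push-forward of `h da` under `A`; Reed–Simon II, §IX.1). [cite: ReedSimonII1975, §IX.1] -/
def averagingMultiplier (A : P →L[ℝ] V) (h : 𝓢(P, ℂ)) : V → ℂ :=
  fun p => 𝓕 (h : P → ℂ) (A.adjoint p)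

/-- Unfolding lemma for `averagingMultiplier`. [folklore] -/
theorem averagingMultiplier_apply (A : P →L[ℝ] V) (h : 𝓢(P, ℂ)) (p : V) :
    averagingMultiplier A h p = 𝓕 (h : P → ℂ) (A.adjoint p) := rfl

/-- `averagingMultiplier A h = 𝓕h ∘ A†` with the Schwartz-space Fourier transform. [folklore] -/
theorem averagingMultiplier_eq_comp (A : P →L[ℝ] V) (h : 𝓢(P, ℂ)) :
    averagingMultiplier A h = (𝓕 h : 𝓢(P, ℂ)) ∘ (A.adjoint : V →L[ℝ] P) := by
  funext p
  simp [averagingMultiplier, SchwartzMap.fourier_coe]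

/-- The symbol has temperate growth (a Schwartz function composed with a linear map). [folklore] -/
theorem averagingMultiplier_hasTemperateGrowth (A : P →L[ℝ] V) (h : 𝓢(P, ℂ)) :
    (averagingMultiplier A h).HasTemperateGrowth := by
  rw [averagingMultiplier_eq_comp]
  exact (SchwartzMap.hasTemperateGrowth _).comp (A.adjoint : V →L[ℝ] P).hasTemperateGrowth

/-- The symbol is continuous. [folklore] -/
theorem continuous_averagingMultiplier (A : P →L[ℝ] V) (h : 𝓢(P, ℂ)) :
    Continuous (averagingMultiplier A h) := by
  rw [averagingMultiplier_eq_comp]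
  exact (SchwartzMap.continuous _).comp (A.adjoint : V →L[ℝ] P).continuous

/-- The symbol is bounded by `‖h‖_{L¹}`. [folklore] -/
theorem norm_averagingMultiplier_le (A : P →L[ℝ] V) (h : 𝓢(P, ℂ)) (p : V) :
    ‖averagingMultiplier A h p‖ ≤ ∫ a, ‖h a‖ :=
  VectorFourier.norm_fourierIntegral_le_integral_norm _ _ _ _ _

end Multiplier

/-! ### The averaging operator and its pointwise formula -/

section Average

variable {P V : Type*}
  [NormedAddCommGroup P] [InnerProductSpace ℝ P] [FiniteDimensional ℝ P]
  [MeasurableSpace P] [BorelSpace P]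
  [NormedAddCommGroup V] [InnerProductSpace ℝ V] [FiniteDimensional ℝ V]
  [MeasurableSpace V] [BorelSpace V]

/-- The **averaging operator** `K_{A,h} : 𝓢(V) →L[ℂ] 𝓢(V)`, defined as the Fourier multiplier with
symbol `𝓕h ∘ A†`; by `translationAverage_apply` it is `u ↦ ∫ h(a) u(· − A a) da`
(Reed–Simon II, §IX.1; the averaged translate in Streater–Wightman's proof of Thm. 3-2 (b)). [cite: ReedSimonII1975, §IX.1] -/
def translationAverage (A : P →L[ℝ] V) (h : 𝓢(P, ℂ)) : 𝓢(V, ℂ) →L[ℂ] 𝓢(V, ℂ) :=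
  SchwartzMap.fourierMultiplierCLM ℂ (averagingMultiplier A h)

/-- `K_{A,h} u = 𝓕⁻¹((𝓕h ∘ A†) • 𝓕u)`. [folklore] -/
theorem translationAverage_eq (A : P →L[ℝ] V) (h : 𝓢(P, ℂ)) (u : 𝓢(V, ℂ)) :
    translationAverage A h u =
      𝓕⁻ (SchwartzMap.smulLeftCLM ℂ (averagingMultiplier A h) (𝓕 u)) := rfl

/-- The Fourier transform of the average is the symbol times `𝓕u`. [folklore] -/
theorem fourier_translationAverage (A : P →L[ℝ] V) (h : 𝓢(P, ℂ)) (u : 𝓢(V, ℂ)) :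
    𝓕 (translationAverage A h u) =
      SchwartzMap.smulLeftCLM ℂ (averagingMultiplier A h) (𝓕 u) := by
  rw [translationAverage_eq, FourierTransform.fourier_fourierInv_eq]

/-- Pointwise: `𝓕(K_{A,h} u)(p) = 𝓕h(A†p) 𝓕u(p)`. [folklore] -/
theorem fourier_translationAverage_apply (A : P →L[ℝ] V) (h : 𝓢(P, ℂ)) (u : 𝓢(V, ℂ)) (p : V) :
    𝓕 (translationAverage A h u) p = averagingMultiplier A h p * 𝓕 u p := by
  rw [fourier_translationAverage,
    SchwartzMap.smulLeftCLM_apply_apply (averagingMultiplier_hasTemperateGrowth A h), smul_eq_mul]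

variable (A : P →L[ℝ] V) (h : 𝓢(P, ℂ)) (u : 𝓢(V, ℂ))

/-- The kernel `(x, a) ↦ h(a) u(x − Aa)` is integrable on `V × P`
(`∫∫ |h(a)| |u(x − Aa)| = ‖h‖₁ ‖u‖₁`). [folklore] -/
theorem integrable_kernel :
    Integrable (fun z : V × P => h z.2 * u (z.1 - A z.2)) (volume.prod volume) := by
  have hmeas : AEStronglyMeasurable (fun z : V × P => h z.2 * u (z.1 - A z.2))
      (volume.prod volume) := by
    refine Continuous.aestronglyMeasurable ?_
    exact (h.continuous.comp continuous_snd).mul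
      (u.continuous.comp (continuous_fst.sub (A.continuous.comp continuous_snd)))
  rw [integrable_prod_iff' hmeas]
  constructor
  · exact Eventually.of_forall fun a => (u.integrable.comp_sub_right (A a)).const_mul (h a)
  · have : (fun a : P => ∫ x : V, ‖h a * u (x - A a)‖) = fun a => ‖h a‖ * ∫ x : V, ‖u x‖ := by
      funext a
      simp only [norm_mul]
      rw [integral_const_mul]
      congr 1
      exact integral_sub_right_eq_self (fun x => ‖u x‖) (A a)
    rw [this]
    exact h.integrable.norm.mul_const _

/-- `x ↦ ∫ h(a) u(x − Aa) da` is integrable on `V`. [folklore] -/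
theorem integrable_average : Integrable (fun x : V => ∫ a, h a * u (x - A a)) :=
  (integrable_kernel A h u).integral_prod_left

omit [FiniteDimensional ℝ V] [MeasurableSpace V] [BorelSpace V] in
/-- `x ↦ ∫ h(a) u(x − Aa) da` is continuous (dominated convergence). [folklore] -/
theorem continuous_average : Continuous (fun x : V => ∫ a, h a * u (x - A a)) := by
  refine continuous_of_dominated (bound := fun a => ‖h a‖ * SchwartzMap.seminorm ℂ 0 0 u)
    (fun x => ?_) (fun x => Eventually.of_forall fun a => ?_) (h.integrable.norm.mul_const _)
    (Eventually.of_forall fun a => ?_)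
  · exact (h.continuous.mul (u.continuous.comp (continuous_const.sub A.continuous))).aestronglyMeasurable
  · rw [norm_mul]
    exact mul_le_mul_of_nonneg_left (u.norm_le_seminorm ℂ _) (norm_nonneg _)
  · exact continuous_const.mul (u.continuous.comp (continuous_id.sub continuous_const))

/-- **Fourier transform of the averaged translate**: `𝓕(∫ h(a) u(· − Aa) da)(p) = 𝓕h(A†p) 𝓕u(p)`
(Fubini, and translation becomes a phase: `𝓕(u(· − v))(p) = e^{-2πi⟨v, p⟩} 𝓕u(p)`;
Reed–Simon II, §IX.1). [cite: ReedSimonII1975, §IX.1] -/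
theorem fourier_average (p : V) :
    𝓕 (fun x : V => ∫ a, h a * u (x - A a)) p =
      averagingMultiplier A h p * 𝓕 (u : V → ℂ) p := by
  have hG := integrable_kernel A h u
  have hph : Continuous fun z : V × P => ((𝐞 (-⟪z.1, p⟫) : Circle) : ℂ) :=
    (Real.continuous_fourierChar.comp (continuous_fst.inner continuous_const).neg).subtype_val
  have hG' : Integrable (fun z : V × P => ((𝐞 (-⟪z.1, p⟫) : Circle) : ℂ) *
      (h z.2 * u (z.1 - A z.2))) (volume.prod volume) :=
    hG.bdd_mul (c := 1) hph.aestronglyMeasurable (Eventually.of_forall fun z => by simp)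
  -- translation of `u` multiplies its Fourier transform by a phase
  have htr : ∀ a : P, ∫ x : V, ((𝐞 (-⟪x, p⟫) : Circle) : ℂ) * u (x - A a) =
      ((𝐞 (-⟪a, A.adjoint p⟫) : Circle) : ℂ) * 𝓕 (u : V → ℂ) p := by
    intro a
    rw [Real.fourier_eq, ← integral_add_right_eq_self
      (fun x : V => ((𝐞 (-⟪x, p⟫) : Circle) : ℂ) * u (x - A a)) (A a)]
    simp only [add_sub_cancel_right, inner_add_left, neg_add, AddChar.map_add_eq_mul,
      Circle.coe_mul, Circle.smul_def]
    rw [ContinuousLinearMap.adjoint_inner_right, ← integral_const_mul]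
    refine integral_congr_ae (Eventually.of_forall fun x => ?_)
    ring
  calc 𝓕 (fun x : V => ∫ a, h a * u (x - A a)) p
      = ∫ x : V, ((𝐞 (-⟪x, p⟫) : Circle) : ℂ) * ∫ a, h a * u (x - A a) := by
        rw [Real.fourier_eq]; simp only [Circle.smul_def, smul_eq_mul]
    _ = ∫ x : V, ∫ a, ((𝐞 (-⟪x, p⟫) : Circle) : ℂ) * (h a * u (x - A a)) := by
        simp only [integral_const_mul]
    _ = ∫ a, ∫ x : V, ((𝐞 (-⟪x, p⟫) : Circle) : ℂ) * (h a * u (x - A a)) :=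
        integral_integral_swap hG'
    _ = ∫ a, h a * ∫ x : V, ((𝐞 (-⟪x, p⟫) : Circle) : ℂ) * u (x - A a) := by
        refine integral_congr_ae (Eventually.of_forall fun a => ?_)
        simp only [mul_left_comm _ (h a), integral_const_mul]
    _ = ∫ a, h a * (((𝐞 (-⟪a, A.adjoint p⟫) : Circle) : ℂ) * 𝓕 (u : V → ℂ) p) := by
        simp only [htr]
    _ = (∫ a, 𝐞 (-⟪a, A.adjoint p⟫) • h a) * 𝓕 (u : V → ℂ) p := by
        rw [← integral_mul_const]
        refine integral_congr_ae (Eventually.of_forall fun a => ?_)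
        simp only [Circle.smul_def, smul_eq_mul]
        ring
    _ = averagingMultiplier A h p * 𝓕 (u : V → ℂ) p := by
        simp only [averagingMultiplier_apply, Real.fourier_eq]

/-- **Pointwise formula for the averaging operator**: `(K_{A,h} u)(x) = ∫ h(a) u(x − A a) da`
(Fourier inversion applied to `fourier_average`; Reed–Simon II, §IX.1). [cite: ReedSimonII1975, §IX.1] -/
theorem translationAverage_apply (x : V) :
    translationAverage A h u x = ∫ a, h a * u (x - A a) := by
  have hF : 𝓕 (fun x : V => ∫ a, h a * u (x - A a)) =
      fun p => averagingMultiplier A h p * 𝓕 (u : V → ℂ) p := funext (fourier_average A h u)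
  have hint : Integrable (𝓕 (fun x : V => ∫ a, h a * u (x - A a))) := by
    rw [hF]
    refine Integrable.bdd_mul (c := ∫ a, ‖h a‖) ?_
      (continuous_averagingMultiplier A h).aestronglyMeasurable
      (Eventually.of_forall (norm_averagingMultiplier_le A h))
    rw [← SchwartzMap.fourier_coe]
    exact (𝓕 u).integrable
  have hinv := (continuous_average A h u).fourierInv_fourier_eq (integrable_average A h u) hint
  have hS : ((SchwartzMap.smulLeftCLM ℂ (averagingMultiplier A h) (𝓕 u) : 𝓢(V, ℂ)) : V → ℂ) =
      𝓕 (fun x : V => ∫ a, h a * u (x - A a)) := by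
    rw [hF]
    funext p
    rw [SchwartzMap.smulLeftCLM_apply_apply (averagingMultiplier_hasTemperateGrowth A h),
      smul_eq_mul, SchwartzMap.fourier_coe]
  rw [translationAverage_eq, SchwartzMap.fourierInv_coe, hS, hinv]

/-! ### Derivatives of the average -/

open LineDeriv

/-- The averaging operator commutes with directional derivatives (two Fourier multipliers
commute). [folklore] -/
theorem translationAverage_lineDerivOp (v : V) (u : 𝓢(V, ℂ)) :
    translationAverage A h (∂_{v} u) = ∂_{v} (translationAverage A h u) := by
  have hm := averagingMultiplier_hasTemperateGrowth A h
  have hg := Function.hasTemperateGrowth_inner_left v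
  have hi : (fun x : V => (RCLike.ofReal (K := ℂ) (inner ℝ x v))).HasTemperateGrowth :=
    (Function.RCLike.hasTemperateGrowth_ofReal ℂ).comp hg
  rw [SchwartzMap.lineDeriv_eq_fourierMultiplierCLM, SchwartzMap.lineDeriv_eq_fourierMultiplierCLM,
    map_smul]
  congr 1
  rw [← SchwartzMap.fourierMultiplierCLM_ofReal ℂ hg u,
    ← SchwartzMap.fourierMultiplierCLM_ofReal ℂ hg (translationAverage A h u), translationAverage,
    SchwartzMap.fourierMultiplierCLM_fourierMultiplierCLM_apply hm hi,
    SchwartzMap.fourierMultiplierCLM_fourierMultiplierCLM_apply hi hm, mul_comm]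

/-- The averaging operator commutes with iterated directional derivatives. [folklore] -/
theorem translationAverage_iteratedLineDerivOp {l : ℕ} (m : Fin l → V) (u : 𝓢(V, ℂ)) :
    translationAverage A h (∂^{m} u) = ∂^{m} (translationAverage A h u) := by
  induction l with
  | zero => simp [LineDeriv.iteratedLineDerivOp_fin_zero]
  | succ l ih =>
    rw [LineDeriv.iteratedLineDerivOp_succ_left, LineDeriv.iteratedLineDerivOp_succ_left,
      translationAverage_lineDerivOp, ih]

omit [FiniteDimensional ℝ V] [MeasurableSpace V] [BorelSpace V] in
/-- Integrability of `a ↦ h(a) Dˡu(x − Aa)` (bounded by `|h(a)| ‖u‖_{0,l}`). [folklore] -/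
theorem integrable_smul_iteratedFDeriv (l : ℕ) (u : 𝓢(V, ℂ)) (x : V) :
    Integrable (fun a : P => h a • iteratedFDeriv ℝ l u (x - A a)) := by
  refine (h.integrable.norm.mul_const (SchwartzMap.seminorm ℂ 0 l u)).mono' ?_
    (Eventually.of_forall fun a => ?_)
  · exact (h.continuous.smul ((u.smooth ⊤).continuous_iteratedFDeriv (mod_cast le_top) |>.comp
      (continuous_const.sub A.continuous))).aestronglyMeasurable
  · rw [norm_smul]
    exact mul_le_mul_of_nonneg_left (u.norm_iteratedFDeriv_le_seminorm ℂ _ _) (norm_nonneg _)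

/-- **Derivatives of the average**: `Dˡ(K_{A,h} u)(x) = ∫ h(a) Dˡu(x − A a) da`
(differentiation commutes with the averaging operator, then the pointwise formula applied to
`∂^{m} u`). [folklore] -/
theorem iteratedFDeriv_translationAverage (l : ℕ) (u : 𝓢(V, ℂ)) (x : V) :
    iteratedFDeriv ℝ l (translationAverage A h u) x = ∫ a, h a • iteratedFDeriv ℝ l u (x - A a) := by
  ext m
  rw [ContinuousMultilinearMap.integral_apply (integrable_smul_iteratedFDeriv A h l u x),
    ← SchwartzMap.iteratedLineDerivOp_eq_iteratedFDeriv, ← translationAverage_iteratedLineDerivOp,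
    translationAverage_apply]
  refine integral_congr_ae (Eventually.of_forall fun a => ?_)
  simp only [smul_apply, smul_eq_mul, SchwartzMap.iteratedLineDerivOp_eq_iteratedFDeriv]

end Average

/-! ### The exchange lemma -/

section Exchange

variable {P V : Type*}
  [NormedAddCommGroup P] [InnerProductSpace ℝ P] [FiniteDimensional ℝ P]
  [MeasurableSpace P] [BorelSpace P]
  [NormedAddCommGroup V] [InnerProductSpace ℝ V] [FiniteDimensional ℝ V]
  [MeasurableSpace V] [BorelSpace V]

variable (A : P →L[ℝ] V) (h : 𝓢(P, ℂ))

omit [FiniteDimensional ℝ P] [MeasurableSpace P] [BorelSpace P] [FiniteDimensional ℝ V]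
  [MeasurableSpace V] [BorelSpace V] in
/-- Continuity of `a ↦ T(u(· − Aa))`. [folklore] -/
theorem continuous_apply_compSubConstCLM (T : 𝓢(V, ℂ) →L[ℂ] ℂ) (u : 𝓢(V, ℂ)) :
    Continuous fun a : P => T (SchwartzMap.compSubConstCLM ℂ (A a) u) :=
  T.continuous.comp ((Literature.MathematicalPhysics.QuantumLattice.continuous_compSubConstCLM (𝕜 := ℂ) u).comp A.continuous)

/-- **Exchange lemma** (Streater–Wightman (1964), §3-3, the step in the proof of Thm. 3-2 (b)
from the vanishing of `∫ e^{ipa}(Ψ₀, φ₁(f₁)…φⱼ(fⱼ)U(-a,1)φⱼ₊₁(fⱼ₊₁)…Ψ₀) da` to the support of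
`W̃`; Reed–Simon II, §IX.1): a tempered distribution commutes with the Schwartz-weighted
average of translates,
`∫ h(a) T(u(· − A a)) da = T(∫ h(a) u(· − A a) da) = T(K_{A,h} u)`.
Proof: the instance `Ψ a = u(· − A a)`, `w = h`, `K = K_{A,h} u` of the tree's general exchange
theorem `SchwartzMap.apply_eq_integral_of_forall_apply_eq_integral` (`SchwartzExchange`): the
family of translates is continuous (`Literature.MathematicalPhysics.QuantumLattice.continuous_compSubConstCLM`) with seminorms of
polynomial growth (`SchwartzMap.exists_seminorm_clm_compSubConstCLM_le`, `SchwartzParametric`),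
the Schwartz weight is polynomially integrable (`SchwartzMap.integrable_one_add_norm_pow_mul`),
and the pointwise identity is `translationAverage_apply`. [cite: StreaterWightman1964, §3-3 proof of Thm. 3-2 (b)] -/
theorem integral_mul_apply_compSubConstCLM (T : 𝓢(V, ℂ) →L[ℂ] ℂ) (u : 𝓢(V, ℂ)) :
    ∫ a, h a * T (SchwartzMap.compSubConstCLM ℂ (A a) u) = T (translationAverage A h u) :=
  (SchwartzMap.apply_eq_integral_of_forall_apply_eq_integral T
    (fun a : P => SchwartzMap.compSubConstCLM ℂ (A a) u)
    ((Literature.MathematicalPhysics.QuantumLattice.continuous_compSubConstCLM (𝕜 := ℂ) u).comp A.continuous)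
    (fun k n => SchwartzMap.exists_seminorm_clm_compSubConstCLM_le
      (ContinuousLinearMap.id ℂ 𝓢(V, ℂ)) u A k n)
    h h.continuous (fun N => SchwartzMap.integrable_one_add_norm_pow_mul h N)
    (translationAverage A h u) (fun x => translationAverage_apply A h u x)).symm

/-- **Continuity in `u`** of the averaged functional `u ↦ ∫ h(a) T(u(· − Aa)) da`: by the exchange
lemma it is the continuous linear functional `T ∘ K_{A,h}`. [folklore] -/
theorem integral_mul_apply_compSubConstCLM_eq_comp (T : 𝓢(V, ℂ) →L[ℂ] ℂ) :
    (fun u : 𝓢(V, ℂ) => ∫ a, h a * T (SchwartzMap.compSubConstCLM ℂ (A a) u)) =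
      ⇑(T.comp (translationAverage A h)) :=
  funext fun u => integral_mul_apply_compSubConstCLM A h T u

omit [FiniteDimensional ℝ V] [MeasurableSpace V] [BorelSpace V] in
/-- Integrability of `a ↦ h(a) T(u(· − Aa))`: `T` is bounded by finitely many Schwartz
seminorms (`Seminorm.bound_of_continuous`), each of polynomial growth along the translates
(`SchwartzMap.exists_seminorm_clm_compSubConstCLM_le`), and Schwartz weights are polynomially
integrable (`SchwartzMap.integrable_one_add_norm_pow_mul`). [folklore] -/
theorem integrable_mul_apply_compSubConstCLM (T : 𝓢(V, ℂ) →L[ℂ] ℂ) (u : 𝓢(V, ℂ)) :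
    Integrable fun a : P => h a * T (SchwartzMap.compSubConstCLM ℂ (A a) u) := by
  obtain ⟨s, C, -, hle⟩ := Seminorm.bound_of_continuous (schwartz_withSeminorms ℂ V ℂ)
    ((normSeminorm ℂ ℂ).comp T.toLinearMap) (continuous_norm.comp T.continuous)
  have hT : ∀ v, ‖T v‖ ≤ C * ∑ m ∈ s, SchwartzMap.seminorm ℂ m.1 m.2 v := fun v => by
    have h1 := Seminorm.le_def.1 hle v
    simp only [Seminorm.comp_apply, coe_normSeminorm, ContinuousLinearMap.coe_coe,
      smul_apply, NNReal.smul_def, smul_eq_mul] at h1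
    refine h1.trans (mul_le_mul_of_nonneg_left ?_ C.2)
    exact Seminorm.finset_sup_apply_le (Finset.sum_nonneg fun m _ => apply_nonneg _ _)
      fun m hm => Finset.single_le_sum (f := fun m : ℕ × ℕ => SchwartzMap.seminorm ℂ m.1 m.2 v)
        (fun _ _ => apply_nonneg _ _) hm
  choose Cg Ng hg using fun m : ℕ × ℕ => SchwartzMap.exists_seminorm_clm_compSubConstCLM_le
    (ContinuousLinearMap.id ℂ 𝓢(V, ℂ)) u A m.1 m.2
  set N : ℕ := s.sup Ng
  set Cs : ℝ := ∑ m ∈ s, |Cg m|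
  have hgrow : ∀ a : P, ‖T (SchwartzMap.compSubConstCLM ℂ (A a) u)‖ ≤ C * (Cs * (1 + ‖a‖) ^ N) := by
    intro a
    refine (hT _).trans (mul_le_mul_of_nonneg_left ?_ C.2)
    rw [Finset.sum_mul]
    refine Finset.sum_le_sum fun m hm => ?_
    have h1a : (1 : ℝ) ≤ 1 + ‖a‖ := by linarith [norm_nonneg a]
    calc SchwartzMap.seminorm ℂ m.1 m.2 (SchwartzMap.compSubConstCLM ℂ (A a) u)
        ≤ Cg m * (1 + ‖a‖) ^ Ng m := hg m a
      _ ≤ |Cg m| * (1 + ‖a‖) ^ N :=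
          mul_le_mul (le_abs_self _) (pow_le_pow_right₀ h1a (Finset.le_sup hm)) (by positivity)
            (abs_nonneg _)
  refine (((SchwartzMap.integrable_one_add_norm_pow_mul h N).const_mul (C * Cs)).mono'
    (h.continuous.mul (continuous_apply_compSubConstCLM A T u)).aestronglyMeasurable
    (Eventually.of_forall fun a => ?_))
  rw [norm_mul]
  calc ‖h a‖ * ‖T (SchwartzMap.compSubConstCLM ℂ (A a) u)‖ ≤ ‖h a‖ * (C * (Cs * (1 + ‖a‖) ^ N)) :=
        mul_le_mul_of_nonneg_left (hgrow a) (norm_nonneg _)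
    _ = C * Cs * ((1 + ‖a‖) ^ N * ‖h a‖) := by ring

end Exchange

end SchwartzAverage

end Literature.Analysis.FunctionSpaces
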